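import Summits.BirchSwinnertonDyer.BirchSwinnertonDyer.Theorems.EisensteinPrimesBSDpOnCellCStubC3HalvesBySign
import Summits.BirchSwinnertonDyer.BirchSwinnertonDyer.Theorems.EisensteinPrimesKellerYinLemma511OfCharacterResidualFiniteness
import Summits.BirchSwinnertonDyer.BirchSwinnertonDyer.Theorems.EisensteinPrimesBSDpOnCellCResidualPub
import Literature.NumberTheory.EllipticCurves.KellerYin2024.CharacterResidualUnrSelmerFinite
import HarnessLib

/-!
# Crux 4 `BSDpOnCellC` (stmt-BirchSwinnertonDyer-19034), line b1: THE PUBLISHED-TIER RESIDUAL AFTER p626493 + p628626 —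
# the crux BY NAME with the `μ`-input = [CGLS22 Prop. 14, PUB] for the NON-SPLIT sign and [Keller–Yin Prop. 1.2.5
# finiteness clause for characters, PRE] for the SPLIT sign (cell `bsd-eis`, seat `bsd-line-x2-p2` gen 4, D-0154 KEY
# row 5; v13-shape residual; companions p626493, p627274, p628626, `…KellerYinLemma511OfCharacterResidualFiniteness`, p613384)

HONEST FRAMING (cell `bsd-eis`, run/shared/lean/pub/bsd-eis/): composition only (no definition, no new named fact,
no `sorry`); a CONDITIONAL-RESULT on 17 published facts + CGLS22 Prop. 14 (published) + Keller–Yin Prop. 1.2.5's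
finiteness clause for characters (preprint, `KellerYin2024.prop125_residualCharacterUnrSelmer_finite_OPEN`) + the
route decls `X2.Nonsplit/SplitKolyvaginDivOnTreeIntOther` (R-β, unprinted) + the frame `μ = 0` and the imprimitive
count at every datum (inline) + crux 3 by name; nothing about any curve is asserted; nothing booked; no label or
count moves; BSD and the main conjectures are proved for NO curve. Helper `--supports stmt-BirchSwinnertonDyer-19034`;
closes no registered stub; the skeleton of record (b1 v12, 155e218d…) is NOT changed by this file (a v13 re-cut
`stub_lemma511 ↦ stub_prop14 [PUB] + stub_prop125 [PRE, character-level]` composes through it; W-79).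

## What

§1 `lemma511_OPEN_of_prop125_OPEN` — v12's `stub_lemma511` BY NAME from the character-level fact (both signs).
§2 `bsdpOnCellC_of_publishedFacts_of_divIntOther_of_prop14_of_prop125_OPEN_of_muFrame_of_imprimitiveCount_of_cellB`:
`…Theses.EisensteinPrimes.BSDpOnCellC` from `hPub` (v12 `stub_publishedFacts` VERBATIM), `hdivN`/`hdivS`
(v12 `stub_divRbeta`), `hprop14 : CastellaGrossiLeeSkinner2022.prop14_residualCharacterSelmer_finite` (PUB; the
NON-SPLIT `μ`-input via p626493), `hprop125 : KellerYin2024.prop125_residualCharacterUnrSelmer_finite_OPEN` (PRE,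
character-level; the SPLIT `μ`-input via `lemma511_OPEN_of_prop125_OPEN` — it would serve the non-split sign too,
but there the published `hprop14` is used), `hmuFN`/`hmuFS` (v12 `stub_muFrame`), `hcountN`/`hcountS` (v12
`stub_imprimitiveCount`), `hMCB` (crux 3). Proof: p613384 ∘ (`StubC3HalvesBySign.invN`, `StubC3HalvesBySign.invS` fed
by §1). Compared with p623440 (v11/v12
sentence: `h511` = Keller–Yin Lemma 5.1.1, an `E`-level preprint claim, both signs) the `E`-level preprint input is
GONE: non-split ↦ published, split ↦ a character-level preprint clause with refereed ingredients.

References: [CastellaGrossiLeeSkinner2022] §1.2 Prop. 14; [KellerYin2024] Prop. 1.2.5, Lemma 5.1.1, Lemma 5.1.2,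
Thm. 5.1.3; [Castella2018Exceptional] Thms. 2.10–2.11; [Hsieh2014] Thm. 1; [LiuZhangZhang2018] Thms. 1.5.1, 1.5.3;
[Miller2011LMS] Def. 1.1; cell p626493, p627274, p628626, p623440, p613384.
-/

set_option autoImplicit false
set_option linter.dupNamespace false -- the summit namespace `…BirchSwinnertonDyer.BirchSwinnertonDyer.Theorems` (Sub = Summit, D-0017) trips it

noncomputable section

open scoped Classical MatrixGroups ModularForm

open CongruenceSubgroup WeierstrassCurve NumberField IsDedekindDomain Field PowerSeries
  Literature.NumberTheory.EllipticCurves Literature.NumberTheory.EllipticCurves.GreenbergSelmer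
  Literature.NumberTheory.EllipticCurves.ModularForms
  Literature.NumberTheory.EllipticCurves.Rank1Residual
  Literature.NumberTheory.EllipticCurves.Rank1Residual.Typed
  Literature.NumberTheory.GaloisRepresentations Literature.NumberTheory.GaloisCohomology
  Literature.NumberTheory.Automorphic
  Summit.BirchSwinnertonDyer.Rank1Residual.X11b.AcSelmer
  Summit.BirchSwinnertonDyer.Rank1Residual.X11b.Halves
  Summit.BirchSwinnertonDyer.Rank1Residual.X11b
  Summit.BirchSwinnertonDyer.Rank1Residual Summit.BirchSwinnertonDyer.Rank1Residual.X2
  Summit.BirchSwinnertonDyer.BirchSwinnertonDyer.Theorems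
open Literature.NumberTheory.EllipticCurves.KellerYin2024
  (curveLocalLambda lemma511_imprimitive_isTorsion_muInvariant_eq_zero_mult_OPEN)
open Literature.NumberTheory.EllipticCurves.CastellaGrossiLeeSkinner2022 (prop14_residualCharacterSelmer_finite)
open Literature.NumberTheory.EllipticCurves.KellerYin2024 (prop125_residualCharacterUnrSelmer_finite_OPEN)

namespace Summit.BirchSwinnertonDyer.BirchSwinnertonDyer.Theorems.BSDpOnCellCResidualV14

/-! ### §1 v12's `stub_lemma511` BY NAME from the character-level named fact -/

/-- **`KellerYin2024.prop125_residualCharacterUnrSelmer_finite_OPEN → KellerYin2024.lemma511_imprimitive_isTorsion_muInvariant_eq_zero_mult_OPEN`**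
— Keller–Yin Lemma 5.1.1 at `p ‖ N` (v12's `stub_lemma511`, BOTH signs) from the CHARACTER-level named preprint fact
(Keller–Yin Prop. 1.2.5, finiteness clause, arbitrary `θ`; p629299), by
`KellerYinLemma511OfCharacterResidualFiniteness.lemma511_OPEN_of_unrCharacterFinite` (strict ⊆ unramified, the
dévissage without the non-anomalous clause p628626, Brink, Greenberg's criterion (A)). CONDITIONAL: one unrefereed
claim (no elliptic curve in it) implies the other. [claim: KellerYin2024, status: under-review]
[cite: KellerYin2024, Prop. 1.2.5 and Lemma 5.1.1 (arXiv:2402.12781v2 §1.2, §5.1 TeX L1744–1749)] -/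
theorem lemma511_OPEN_of_prop125_OPEN (hprop125 : prop125_residualCharacterUnrSelmer_finite_OPEN) :
    lemma511_imprimitive_isTorsion_muInvariant_eq_zero_mult_OPEN :=
  KellerYinLemma511OfCharacterResidualFiniteness.lemma511_OPEN_of_unrCharacterFinite
    fun K _ _ p _ hK hp2 hsplit κ hκ 𝔭 h𝔭 M _ _ _ _ hM hcont S hS hSmem hunr ↦
      hprop125 K p hK hp2 hsplit κ hκ 𝔭 h𝔭 M hM hcont S hS hSmem hunr

/-- The SPLIT-restricted form of Keller–Yin Lemma 5.1.1 (the hypothesis `h511S` of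
`StubC3HalvesBySign.invS_of_lemma511Split_of_muFrame_of_imprimitiveCount`) from the character-level fact: the extra
binder `W.HasSplitMultiplicativeReductionAtPrime p` is simply dropped. [claim: KellerYin2024, status: under-review]
[cite: KellerYin2024, Prop. 1.2.5 and Lemma 5.1.1 (arXiv:2402.12781v2)] -/
theorem lemma511Split_of_prop125_OPEN (hprop125 : prop125_residualCharacterUnrSelmer_finite_OPEN) :
    ∀ {p : ℕ} [Fact p.Prime] (W : WeierstrassCurve ℚ) [W.IsElliptic] [W.IsGloballyMinimal]
      (K : Type) [Field K] [NumberField K] (vbar : HeightOneSpectrum (𝓞 K))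
      (κ : ZpExtension K p) (γ : absoluteGaloisGroup K) [Fact (κ.IsTopGenerator γ)]
      (Sf : Finset (HeightOneSpectrum (𝓞 K))),
      2 < p → Mult W p → W.HasSplitMultiplicativeReductionAtPrime p → Red W p →
      IsImaginaryQuadratic K → SatisfiesHeegnerHypothesis (W.conductorNorm ℤ) K →
        Odd (NumberField.discr K) → NumberField.discr K ≠ -3 →
        ((Ideal.span {(p : ℤ)}).primesOver (𝓞 K)).ncard = 2 →
      ((p : ℕ) : 𝓞 K) ∈ vbar.asIdeal → κ.IsAnticyclotomic →
      (∀ w : HeightOneSpectrum (𝓞 K), w ∈ Sf ↔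
        (((W.conductorNorm ℤ : ℤ) : 𝓞 K) ∈ w.asIdeal ∧ ((p : ℕ) : 𝓞 K) ∉ w.asIdeal)) →
      Module.IsTorsion (IwasawaAlgebra p)
          (Castella2018.AcSelmer.XAc (W.baseChange K) p κ vbar (↑Sf : Set (HeightOneSpectrum (𝓞 K))) γ) ∧
        muInvariant p
          (Castella2018.AcSelmer.XAc (W.baseChange K) p κ vbar (↑Sf : Set (HeightOneSpectrum (𝓞 K))) γ) = 0 :=
  fun W _ _ K _ _ vbar κ γ _ Sf hp hmult _ hred hK hH hodd h3 hsplit hvbar hκ hSf ↦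
    lemma511_OPEN_of_prop125_OPEN hprop125 W K vbar κ γ Sf hp hmult hred hK hH hodd h3 hsplit hvbar hκ hSf

open Literature.NumberTheory.EllipticCurves.GreenbergVatsal2000 Literature.NumberTheory.QuadraticFields
  Literature.NumberTheory.EllipticCurves.KrizLi2019 Literature.NumberTheory.EllipticCurves.Wuthrich2014
  Literature.NumberTheory.EllipticCurves.SteinWuthrich2013 Literature.NumberTheory.EllipticCurves.Castella2018Exceptional
  Summit.BirchSwinnertonDyer.Rank1Residual.X1

/-! ### §2 The crux BY NAME: `μ`-input = prop14 [PUB] (non-split) + prop125 [PRE] (split) -/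

/-- **Crux 4 `BSDpOnCellC` BY NAME from [17 PUB facts] + [road R-β] + [CGLS22 Prop. 14, PUB — non-split `μ`-input] +
[Keller–Yin Prop. 1.2.5 finiteness clause for characters, PRE — split `μ`-input] + [`μ(𝓛^BDP_𝔭) = 0` and the
IMPRIMITIVE count at every datum] + [crux 3].** Composition = p613384 with `hinvN` from
`StubC3HalvesBySign.invN_of_prop14_of_muFrame_of_imprimitiveCount` and `hinvS` from
`StubC3HalvesBySign.invS_of_lemma511Split_of_muFrame_of_imprimitiveCount` fed by
§1 (`lemma511_OPEN_of_prop125_OPEN hprop125`, restricted to split `p`).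
CONDITIONAL-RESULT: the honest published-tier price of the crux on line b1 after this seat; BSD is proved for no curve.
[claim: KellerYin2024, status: under-review]
[cite: CastellaGrossiLeeSkinner2022, §1.2 Prop. 14 (arXiv:2008.02571; Invent. Math. 227 (2022))]
[cite: KellerYin2024, Prop. 1.2.5, Lemma 5.1.1 (L1744–1749), Lemma 5.1.2 (L1750–1769), Thm. 5.1.3 = Thm. D (arXiv:2402.12781v2) (shape only)]
[cite: Castella2018Exceptional, Thm. 2.10 and Thm. 2.11] [cite: LiuZhangZhang2018, Thm. 1.5.1 and Thm. 1.5.3]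
[cite: Hsieh2014, Thm. 1] [cite: Miller2011LMS, Def. 1.1] -/
theorem bsdpOnCellC_of_publishedFacts_of_divIntOther_of_prop14_of_prop125_OPEN_of_muFrame_of_imprimitiveCount_of_cellB
    (hPub : ((lambdaMu_multiplicative_of_gvPar ∧ thm16_charIdeal_dvd_multiplicative_of_reducible ∧
      thm61_splitMultiplicative ∧ thm61_nonsplitMultiplicative ∧
      (∀ (W : WeierstrassCurve ℚ) [W.IsElliptic] [W.IsGloballyMinimal] (p : ℕ) [Fact p.Prime],
        greenberg_stevens (W := W) (p := p)) ∧
      exists_isNewformOf ∧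
      (∀ (K : Type) [Field K] [NumberField K], poitouTate_selmerStructure_duality K) ∧
      (∀ (K : Type) [Field K] [NumberField K], poitouTate_sha_tateDual K) ∧
      hsieh2014_exists_anticyclotomicPAdicLFunction ∧
      (∀ (N : ℕ) [NeZero N] (W : WeierstrassCurve ℚ) (K : Type) [Field K] [NumberField K],
        gross_zagier N W K) ∧
      (∀ (N : ℕ) [NeZero N] (W : WeierstrassCurve ℚ) (K : Type) [Field K] [NumberField K],
        kolyvagin N W K) ∧
      rank_eq_analyticRank_of_analyticRank_le_one ∧ HoffsteinLuo1997_exists_twist_L_one_ne_zero ∧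
      mazur_not_dvd_maninConstant_of_odd ∧ bsdRHS_eq_of_isIsogenous) ∧
      thm210_thm211_bdpDisplay_pNew) ∧
      LiuZhangZhang2018.thm151_thm153_modularCurve_heegnerVector)
    (hdivN : ∀ (W : WeierstrassCurve ℚ) [W.IsElliptic] [W.IsGloballyMinimal] (p : ℕ) [Fact p.Prime],
      CellC W p → ¬ W.HasSplitMultiplicativeReductionAtPrime p → NonsplitKolyvaginDivOnTreeIntOther W p)
    (hdivS : ∀ (W : WeierstrassCurve ℚ) [W.IsElliptic] [W.IsGloballyMinimal] (p : ℕ) [Fact p.Prime],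
      CellC W p → W.HasSplitMultiplicativeReductionAtPrime p → SplitKolyvaginDivOnTreeIntOther W p)
    (hprop14 : prop14_residualCharacterSelmer_finite)
    (hprop125 : prop125_residualCharacterUnrSelmer_finite_OPEN)
    (hmuFN :
      ∀ (W : WeierstrassCurve ℚ) [W.IsElliptic] [W.IsGloballyMinimal] (p : ℕ) [Fact p.Prime],
        ∀ (N : ℕ) [NeZero N] (K : Type) [Field K] [NumberField K] (Dt : ModularParametrizationData W N)
          (H : HeegnerDatum N (NumberField.discr K)) (ιK : K →+* ℂ) (P : (W.baseChange K).toAffine.Point),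
          CellC W p → ¬ W.HasSplitMultiplicativeReductionAtPrime p → W.conductorNorm ℤ = N →
          IsImaginaryQuadratic K → NumberField.discr K < -4 → SatisfiesHeegnerHypothesis N K →
          (W.quadraticTwist (NumberField.discr K : ℚ)).entireLFunction 1 ≠ 0 →
          WeierstrassCurve.Affine.Point.map ιK.toRatAlgHom P = heegnerPointComplex Dt H →
          ¬ (p : ℤ) ∣ Dt.c → ¬ IsOfFinAddOrder P →
          Odd (NumberField.discr K) →
          ∀ (κ : ZpExtension K p), κ.IsAnticyclotomic →
            ∀ (γ : Field.absoluteGaloisGroup K) [Fact (κ.IsTopGenerator γ)]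
              (𝔭 : HeightOneSpectrum (𝓞 K)), ((p : ℕ) : 𝓞 K) ∈ 𝔭.asIdeal →
              𝔭.asIdeal.ramificationIdx (𝓞 ℚ) = 1 → 𝔭.asIdeal.inertiaDeg (𝓞 ℚ) = 1 →
              ∀ (𝔭bar : HeightOneSpectrum (𝓞 K)), ((p : ℕ) : 𝓞 K) ∈ 𝔭bar.asIdeal → 𝔭bar ≠ 𝔭 →
                ((Ideal.span {(p : ℤ)}).primesOver (𝓞 K)).ncard = 2 →
              ∀ (f : CuspForm (CongruenceSubgroup.Gamma0 N) 2), IsNewformOf W f →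
                ∀ (ι' : PadicAlgCl p ≃+* ℂ),
                  (∀ (w : InfinitePlace K) (k : 𝓞 K),
                    k ∈ 𝔭.asIdeal ↔ ‖ι'.symm (w.embedding (k : K))‖ < 1) →
                  ∀ (ΩK : ℂ) (Ωp : ℂ_[p]) (Q : PowerSeries 𝓞_ℂ_[p]), ΩK ≠ 0 → ‖Ωp‖ = 1 →
                    R1.IsBDPLFunctionInt p ι' 𝔭 κ γ f ΩK Ωp Q →
                      ∃ m : ℕ, ‖((PowerSeries.coeff m Q : 𝓞_ℂ_[p]) : ℂ_[p])‖ = 1 ∧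
                  ∀ i < m, ‖((PowerSeries.coeff i Q : 𝓞_ℂ_[p]) : ℂ_[p])‖ < 1)
    (hmuFS :
      ∀ (W : WeierstrassCurve ℚ) [W.IsElliptic] [W.IsGloballyMinimal] (p : ℕ) [Fact p.Prime],
        ∀ (N : ℕ) [NeZero N] (K : Type) [Field K] [NumberField K] (Dt : ModularParametrizationData W N)
          (H : HeegnerDatum N (NumberField.discr K)) (ιK : K →+* ℂ) (P : (W.baseChange K).toAffine.Point),
          CellC W p → W.HasSplitMultiplicativeReductionAtPrime p → W.conductorNorm ℤ = N →
          IsImaginaryQuadratic K → NumberField.discr K < -4 → SatisfiesHeegnerHypothesis N K →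
          (W.quadraticTwist (NumberField.discr K : ℚ)).entireLFunction 1 ≠ 0 →
          WeierstrassCurve.Affine.Point.map ιK.toRatAlgHom P = heegnerPointComplex Dt H →
          ¬ (p : ℤ) ∣ Dt.c → ¬ IsOfFinAddOrder P →
          Odd (NumberField.discr K) →
          ∀ (κ : ZpExtension K p), κ.IsAnticyclotomic →
            ∀ (γ : Field.absoluteGaloisGroup K) [Fact (κ.IsTopGenerator γ)]
              (𝔭 : HeightOneSpectrum (𝓞 K)), ((p : ℕ) : 𝓞 K) ∈ 𝔭.asIdeal →
              𝔭.asIdeal.ramificationIdx (𝓞 ℚ) = 1 → 𝔭.asIdeal.inertiaDeg (𝓞 ℚ) = 1 →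
              ∀ (𝔭bar : HeightOneSpectrum (𝓞 K)), ((p : ℕ) : 𝓞 K) ∈ 𝔭bar.asIdeal → 𝔭bar ≠ 𝔭 →
                ((Ideal.span {(p : ℤ)}).primesOver (𝓞 K)).ncard = 2 →
              ∀ (f : CuspForm (CongruenceSubgroup.Gamma0 N) 2), IsNewformOf W f →
                ∀ (ι' : PadicAlgCl p ≃+* ℂ),
                  (∀ (w : InfinitePlace K) (k : 𝓞 K),
                    k ∈ 𝔭.asIdeal ↔ ‖ι'.symm (w.embedding (k : K))‖ < 1) →
                  ∀ (ΩK : ℂ) (Ωp : ℂ_[p]) (Q : PowerSeries 𝓞_ℂ_[p]), ΩK ≠ 0 → ‖Ωp‖ = 1 →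
                    R1.IsBDPLFunctionInt p ι' 𝔭 κ γ f ΩK Ωp Q →
                      ∃ m : ℕ, ‖((PowerSeries.coeff m Q : 𝓞_ℂ_[p]) : ℂ_[p])‖ = 1 ∧
                  ∀ i < m, ‖((PowerSeries.coeff i Q : 𝓞_ℂ_[p]) : ℂ_[p])‖ < 1)
    (hcountN :
      ∀ (W : WeierstrassCurve ℚ) [W.IsElliptic] [W.IsGloballyMinimal] (p : ℕ) [Fact p.Prime],
        ∀ (N : ℕ) [NeZero N] (K : Type) [Field K] [NumberField K] (Dt : ModularParametrizationData W N)
          (H : HeegnerDatum N (NumberField.discr K)) (ιK : K →+* ℂ) (P : (W.baseChange K).toAffine.Point),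
          CellC W p → ¬ W.HasSplitMultiplicativeReductionAtPrime p → W.conductorNorm ℤ = N →
          IsImaginaryQuadratic K → NumberField.discr K < -4 → SatisfiesHeegnerHypothesis N K →
          (W.quadraticTwist (NumberField.discr K : ℚ)).entireLFunction 1 ≠ 0 →
          WeierstrassCurve.Affine.Point.map ιK.toRatAlgHom P = heegnerPointComplex Dt H →
          ¬ (p : ℤ) ∣ Dt.c → ¬ IsOfFinAddOrder P →
          Odd (NumberField.discr K) →
          ∀ (κ : ZpExtension K p), κ.IsAnticyclotomic →
            ∀ (γ : Field.absoluteGaloisGroup K) [Fact (κ.IsTopGenerator γ)]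
              (𝔭 : HeightOneSpectrum (𝓞 K)), ((p : ℕ) : 𝓞 K) ∈ 𝔭.asIdeal →
              𝔭.asIdeal.ramificationIdx (𝓞 ℚ) = 1 → 𝔭.asIdeal.inertiaDeg (𝓞 ℚ) = 1 →
              ∀ (𝔭bar : HeightOneSpectrum (𝓞 K)), ((p : ℕ) : 𝓞 K) ∈ 𝔭bar.asIdeal → 𝔭bar ≠ 𝔭 →
                ((Ideal.span {(p : ℤ)}).primesOver (𝓞 K)).ncard = 2 →
              ∀ (f : CuspForm (CongruenceSubgroup.Gamma0 N) 2), IsNewformOf W f →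
                ∀ (ι' : PadicAlgCl p ≃+* ℂ),
                  (∀ (w : InfinitePlace K) (k : 𝓞 K),
                    k ∈ 𝔭.asIdeal ↔ ‖ι'.symm (w.embedding (k : K))‖ < 1) →
                  ∀ (ΩK : ℂ) (Ωp : ℂ_[p]) (Q : PowerSeries 𝓞_ℂ_[p]), ΩK ≠ 0 → ‖Ωp‖ = 1 →
                    R1.IsBDPLFunctionInt p ι' 𝔭 κ γ f ΩK Ωp Q →
                      ∀ (Sf : Finset (HeightOneSpectrum (𝓞 K))),
                        (∀ w : HeightOneSpectrum (𝓞 K), w ∈ Sf ↔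
                          (((W.conductorNorm ℤ : ℤ) : 𝓞 K) ∈ w.asIdeal ∧ ((p : ℕ) : 𝓞 K) ∉ w.asIdeal)) →
                        ∀ m : ℕ, ‖((PowerSeries.coeff m Q : 𝓞_ℂ_[p]) : ℂ_[p])‖ = 1 →
                          (∀ i < m, ‖((PowerSeries.coeff i Q : 𝓞_ℂ_[p]) : ℂ_[p])‖ < 1) →
                            m + ∑ w ∈ Sf, curveLocalLambda κ (W.baseChange K) w ≤
                              lambdaInvariant p (XAc (W.baseChange K) p κ 𝔭bar (↑Sf : Set (HeightOneSpectrum (𝓞 K))) γ))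
    (hcountS :
      ∀ (W : WeierstrassCurve ℚ) [W.IsElliptic] [W.IsGloballyMinimal] (p : ℕ) [Fact p.Prime],
        ∀ (N : ℕ) [NeZero N] (K : Type) [Field K] [NumberField K] (Dt : ModularParametrizationData W N)
          (H : HeegnerDatum N (NumberField.discr K)) (ιK : K →+* ℂ) (P : (W.baseChange K).toAffine.Point),
          CellC W p → W.HasSplitMultiplicativeReductionAtPrime p → W.conductorNorm ℤ = N →
          IsImaginaryQuadratic K → NumberField.discr K < -4 → SatisfiesHeegnerHypothesis N K →
          (W.quadraticTwist (NumberField.discr K : ℚ)).entireLFunction 1 ≠ 0 →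
          WeierstrassCurve.Affine.Point.map ιK.toRatAlgHom P = heegnerPointComplex Dt H →
          ¬ (p : ℤ) ∣ Dt.c → ¬ IsOfFinAddOrder P →
          Odd (NumberField.discr K) →
          ∀ (κ : ZpExtension K p), κ.IsAnticyclotomic →
            ∀ (γ : Field.absoluteGaloisGroup K) [Fact (κ.IsTopGenerator γ)]
              (𝔭 : HeightOneSpectrum (𝓞 K)), ((p : ℕ) : 𝓞 K) ∈ 𝔭.asIdeal →
              𝔭.asIdeal.ramificationIdx (𝓞 ℚ) = 1 → 𝔭.asIdeal.inertiaDeg (𝓞 ℚ) = 1 →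
              ∀ (𝔭bar : HeightOneSpectrum (𝓞 K)), ((p : ℕ) : 𝓞 K) ∈ 𝔭bar.asIdeal → 𝔭bar ≠ 𝔭 →
                ((Ideal.span {(p : ℤ)}).primesOver (𝓞 K)).ncard = 2 →
              ∀ (f : CuspForm (CongruenceSubgroup.Gamma0 N) 2), IsNewformOf W f →
                ∀ (ι' : PadicAlgCl p ≃+* ℂ),
                  (∀ (w : InfinitePlace K) (k : 𝓞 K),
                    k ∈ 𝔭.asIdeal ↔ ‖ι'.symm (w.embedding (k : K))‖ < 1) →
                  ∀ (ΩK : ℂ) (Ωp : ℂ_[p]) (Q : PowerSeries 𝓞_ℂ_[p]), ΩK ≠ 0 → ‖Ωp‖ = 1 →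
                    R1.IsBDPLFunctionInt p ι' 𝔭 κ γ f ΩK Ωp Q →
                      ∀ (Sf : Finset (HeightOneSpectrum (𝓞 K))),
                        (∀ w : HeightOneSpectrum (𝓞 K), w ∈ Sf ↔
                          (((W.conductorNorm ℤ : ℤ) : 𝓞 K) ∈ w.asIdeal ∧ ((p : ℕ) : 𝓞 K) ∉ w.asIdeal)) →
                        ∀ m : ℕ, ‖((PowerSeries.coeff m Q : 𝓞_ℂ_[p]) : ℂ_[p])‖ = 1 →
                          (∀ i < m, ‖((PowerSeries.coeff i Q : 𝓞_ℂ_[p]) : ℂ_[p])‖ < 1) →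
                            m + ∑ w ∈ Sf, curveLocalLambda κ (W.baseChange K) w ≤
                              lambdaInvariant p (XAc (W.baseChange K) p κ 𝔭bar (↑Sf : Set (HeightOneSpectrum (𝓞 K))) γ))
    (hMCB : Summit.BirchSwinnertonDyer.BirchSwinnertonDyer.Theses.EisensteinPrimes.MazurMCOnCellB) :
    Summit.BirchSwinnertonDyer.BirchSwinnertonDyer.Theses.EisensteinPrimes.BSDpOnCellC :=
  BSDpOnCellCResidualPub.bsdpOnCellC_of_publishedFacts_of_divIntOther_of_oneInequality_of_cellB hPub hdivN hdivS
    (StubC3HalvesBySign.invN_of_prop14_of_muFrame_of_imprimitiveCount hprop14 hmuFN hcountN)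
    (StubC3HalvesBySign.invS_of_lemma511Split_of_muFrame_of_imprimitiveCount
      (lemma511Split_of_prop125_OPEN hprop125) hmuFS hcountS) hMCB

end Summit.BirchSwinnertonDyer.BirchSwinnertonDyer.Theorems.BSDpOnCellCResidualV14

end
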